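import Literature.MathematicalPhysics.QuantumFieldTheory.Balaban1983to89.B9Eq349BlockMultipliers
import Literature.MathematicalPhysics.QuantumFieldTheory.Balaban1983to89.B9Eq319QprimeTorus

/-!
# `Balaban1983to89.B9Eq342BlockDecayWeightedSum` — T. Bałaban, *Propagators for lattice gauge theories in a background field*, Commun. Math. Phys.
# **99** (1985) 389–434 [Balaban1985BackgroundPropagators] Thm 3.1 (3.42) p. 397 (the decay factor `e^{−δ₀d(y,y′)}` *«for x ∈ Δ(y), y ∈ Λ_j,
# supp λ ⊂ Δ(y′)»*), (3.49) p. 399, p. 415 *«random walk expansion»*: **(D-E) — THE CHAIN's `L²` BLOCK DECAY PLUMBED INTO THE WEIGHTED SUMS OF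
# STOREY (D).  If `f` has block decay `‖P_y f‖ ≤ C·e^{−κδ(y,v)}` away from a source block `v` (e.g. `f = T g`, `g` supported in `v`, `T` with the
# block-decay letter `‖P_y∘T∘P_v‖ ≤ Ce^{−κδ(y,v)}`) and a weight `W > 0` on sites dominates `e^{κ₁δ(u,π x)} ≤ M·W(x)` around an output block `u`,
# then (i) POINTWISE `‖P_{π x} f‖ ≤ C·M·e^{−κ′δ(u,v)}·W(x)` and (ii) the WEIGHTED BRACKET `Σ_x w(x)‖f(x)‖²∕W(x) ≤ M·C²·S·e^{−κ′δ(u,v)}` for every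
# slower rate `0 ≤ κ′ ≤ 2κ`, `S = Σ_y e^{−(κ₁−κ′)δ(u,y)}`; on the lattice (`κ′ < κ₁`) `S = K_d(κ₁−κ′)` VOLUME-FREE (the weight's domination letter `hW` is
# inhabited in the companion `B9Eq342CoshWeightBlockDistance`)** — [folklore] bookkeeping for storey (D) «decay in `d(y,y′)`» of the NE9 owner's SUP-NORM PROGRAMME
# (plan v10 `t4/b2b-balaban-t4-ne9-p1/g89/SUP-NORM-PROGRAMME.md` §5 item (D-E); steps 2 and 4 of ne9-leaf-02 g71's `D-ASSEMBLY-NOTE.md`)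

statement-level skeleton of published theorems with citation tags; proofs where landed; nothing here is a claim about the Yang–Mills mass gap

CITATION HEADER (lean-in-tree rule).  Audit cell `pub-balaban`, sub-cell `t4`, BINDER row NE9; filed by NE9 formalisation-swarm LEAF PROVER 06
(`b2b-balaban-t4-ne9-formalise-leaf-06`, gen 70; the road-B8″ block-decay lineage named among the first refusals of storey (D) in plan v10 §5).  Source READ
in the held text [Balaban1985BackgroundPropagators]: p. 397 Thm 3.1 (3.42) with its decay factor *«e^{−δ₀d(y,y′)} for x ∈ Δ(y), y ∈ Λ_j, supp λ ⊂ Δ(y′)»*,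
p. 399 (3.49) (the unit-lattice blocks `Δ(y)`), p. 415 *«… random walk expansion …»* (the METHOD print uses for the decay; the cell's storey (D) substitutes
positivity + the chain's `L²` block decay, see `B9Eq342SupNormBootstrapWeighted`).  NOTHING printed is asserted: every statement below is finite-sum
bookkeeping over DISPLAYED letters (a block family `P` with its pointwise letter `hP` — `B9Eq349BlockMultipliers` —, a pseudo-metric `δ`, a block-decay
letter, a weight-domination letter).

WHAT IS PROVED (sorry-free; proof lane — no `def`; [folklore]).
* §1 (finite `Y`, pseudo-metric `δ`: nonneg + triangle): `sum_exp_mul_exp_le` (`Σ_y e^{−κ₁δ(u,y)}e^{−κ₂δ(y,v)} ≤ S·e^{−κ′δ(u,v)}`, `0 ≤ κ′ ≤ κ₂`,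
  `Σ_{y′} e^{−(κ₁−κ′)δ(y,y′)} ≤ S` — sibling of `B9Eq349KernelConvolutionDecay.sum_sum_exp_triangle_le`); `sum_mul_le_of_fiber_decay` (`Σ_x ω g ≤ M·G·S·e^{−κ′δ(u,v)}`
  for `0 ≤ g` with fibre sums `≤ G e^{−κ₂δ(y,v)}` and `ω ≤ M e^{−κ₁δ(u,πx)}`).
* §2 (`WL2 𝕜 w V`, (K1) family `P`∕`hP` over `π : X → Y`): `norm_block_apply_le_of_block_decay` (`P_v g = g`, `‖P_y∘T∘P_v‖ ≤ Ce^{−κδ(y,v)}` ⟹ `‖P_y(Tg)‖ ≤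
  Ce^{−κδ(y,v)}‖g‖`); `norm_block_apply_le_weight` — the DATA-vs-WEIGHT letter (i) (× (D-P)'s `p₂` = the `q`-half of `‖f y‖ + ‖q y‖ ≤ sλW y`);
  `norm_apply_le_weight_of_support` — its `f`-half (`f` supported in the block `v`); `weighted_sum_norm_sq_le_of_block_decay(_op)` — the (D-FS) bracket (ii).
* §3 (lattice `X = T_{Lm}`, `Y = T_m`, `π = blockCoord`, `δ = d_m`; block decay SOURCE-FIRST `e^{−κ d_m(v,y)}` = (K6T)'s `hdec` ∕ `exists_block_decay_Gp` verbatim;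
  the weight enters ONLY through the displayed domination letter `hW : e^{κ₁·d_m(u, π x)} ≤ M·W x` — its inhabitants (matched units `e^{aL·d_m} ≤ e^{a(L−1)}e^{a·d_{Lm}}`,
  the (D-MP) `cosh` product weight in `TSite` and in `Tor` spelling) are the companion file `B9Eq342CoshWeightBlockDistance`):
  `norm_apply_le_weight_of_support_lattice`; `norm_block_apply_le_weight_lattice`; `weighted_sum_norm_sq_le_of_block_decay_lattice` ∕ `…_op_lattice` with
  `S = latticeConst d (κ₁ − κ′)` by `B4Sect5Torus.torusSum_le` — VOLUME-FREE.
HONEST SCOPE.  Plumbing only: the block decay of the chain's `G′(U)` (ne9-leaf-01 g84 `B9Eq349ConjugatedGreenBlockDecay.exists_block_decay_Gp`, in its window),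
the weight ((D-MP); its domination letter `hW` — companion file) and its `Tor ↔ TSite` stencil transport, the block-local penalty (ne9-leaf-03's (D-P)), the decayed free letter
(ne9-leaf-02's (D-FS)) and the assembly (D-A) are the CONSUMER's; nothing of [B9] Thm 3.1 is asserted or valued; VALUE row bookkeeping only, no ∇-row.  NOT NE9
(cell pub-balaban: NE9 NOT PRINTED ∕ NOT PROVED; «NE9 ⇐ the named binders»; row WALLED ON A MODEL (O-NE9-1; #5 UNRULED); spine PROVED 0∕9; rung (B)+1 on a finite
T⁴ — NOT infinite volume, NOT mass gap, NOT Clay; HONEST DEPENDENCY: continuum YM on T⁴ ⇐ BetaPertH ∧ nine spine estimates (0/9 proved); BetaPertH ⇐ (D1) ∧ (D4) ∧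
CAP+tail; G-an2-4 gates asym, D1 and NE2/3/4).  NEW file importing `B9Eq349BlockMultipliers`, `B9Eq319QprimeTorus` only; nothing modified.  Net new unproved facts: 0.
-/

noncomputable section

open scoped BigOperators

namespace Literature.MathematicalPhysics.QuantumFieldTheory.Balaban1983to89.B9Eq342BlockDecayWeightedSum

open B4Sect5Torus (TSite tdist tdist_symm tdist_triangle tdist_nonneg torusSum_le)
open B4Sect5Proof (latticeConst)
open B9Eq311L2Pairing (WL2)
open B9Eq319QprimeTorus (fineP blockCoord)
open B9Eq349BlockMultipliers (norm_sq_block_apply)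

/-! ## §1 Two decaying kernels summed over a finite index with a pseudo-metric -/

section Conv

variable {Y : Type*} [Fintype Y] {δ : Y → Y → ℝ}
  (hδ0 : ∀ y y', 0 ≤ δ y y') (hδt : ∀ u y v, δ u v ≤ δ u y + δ y v)

include hδ0 hδt in
/-- **TWO DECAYING KERNELS SUM TO A DECAYING KERNEL**: `Σ_y e^{−κ₁δ(u,y)}·e^{−κ₂δ(y,v)} ≤ S·e^{−κ′δ(u,v)}` for every `0 ≤ κ′ ≤ κ₂` with
`Σ_y e^{−(κ₁−κ′)δ(u,y)} ≤ S` (the `κ′`-part by the triangle inequality, the surplus `κ₁ − κ′` of the first factor summed; useful for `κ′ < κ₁`). [folklore]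
[cite: Balaban1985BackgroundPropagators, p.415 «random walk expansion», Thm 3.1 (3.42) p.397] -/
theorem sum_exp_mul_exp_le {κ₁ κ₂ κ' S : ℝ} (hκ' : 0 ≤ κ') (h2 : κ' ≤ κ₂)
    (hS : ∀ y, ∑ y', Real.exp (-((κ₁ - κ') * δ y y')) ≤ S) (u v : Y) :
    ∑ y, Real.exp (-(κ₁ * δ u y)) * Real.exp (-(κ₂ * δ y v)) ≤ S * Real.exp (-(κ' * δ u v)) := by
  have hterm : ∀ y, Real.exp (-(κ₁ * δ u y)) * Real.exp (-(κ₂ * δ y v)) ≤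
      Real.exp (-((κ₁ - κ') * δ u y)) * Real.exp (-(κ' * δ u v)) := by
    intro y
    rw [← Real.exp_add, ← Real.exp_add]
    apply Real.exp_le_exp.mpr
    have h3 : κ' * δ u v ≤ κ' * (δ u y + δ y v) := mul_le_mul_of_nonneg_left (hδt u y v) hκ'
    have h4 : κ' * δ y v ≤ κ₂ * δ y v := mul_le_mul_of_nonneg_right h2 (hδ0 _ _)
    linarith
  calc ∑ y, Real.exp (-(κ₁ * δ u y)) * Real.exp (-(κ₂ * δ y v))
      ≤ ∑ y, Real.exp (-((κ₁ - κ') * δ u y)) * Real.exp (-(κ' * δ u v)) := Finset.sum_le_sum fun y _ => hterm y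
    _ = (∑ y, Real.exp (-((κ₁ - κ') * δ u y))) * Real.exp (-(κ' * δ u v)) := by rw [Finset.sum_mul]
    _ ≤ S * Real.exp (-(κ' * δ u v)) := mul_le_mul_of_nonneg_right (hS u) (Real.exp_pos _).le

include hδ0 hδt in
/-- **A WEIGHTED SUM OVER SITES WITH FIBREWISE DECAY**: `π : X → Y`, `0 ≤ g` with fibre sums `Σ_{π x = y} g(x) ≤ G·e^{−κ₂δ(y,v)}` (`0 ≤ G`), and a
weight `ω(x) ≤ M·e^{−κ₁δ(u,π x)}` (`0 ≤ M`) ⟹ `Σ_x ω(x)·g(x) ≤ M·G·S·e^{−κ′δ(u,v)}` (`0 ≤ κ′ ≤ κ₂`, `Σ_{y′} e^{−(κ₁−κ′)δ(y,y′)} ≤ S`).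
[folklore] [cite: Balaban1985BackgroundPropagators, Thm 3.1 (3.42) p.397, (3.49) p.399] -/
theorem sum_mul_le_of_fiber_decay {X : Type*} [Fintype X] [DecidableEq Y] (π : X → Y) (u v : Y)
    {g ω : X → ℝ} (hg : ∀ x, 0 ≤ g x)
    {M κ₁ : ℝ} (hM : 0 ≤ M) (hω : ∀ x, ω x ≤ M * Real.exp (-(κ₁ * δ u (π x))))
    {G κ₂ : ℝ} (hG : 0 ≤ G) (hblk : ∀ y, ∑ x, (if π x = y then g x else 0) ≤ G * Real.exp (-(κ₂ * δ y v)))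
    {κ' S : ℝ} (hκ' : 0 ≤ κ') (h2 : κ' ≤ κ₂) (hS : ∀ y, ∑ y', Real.exp (-((κ₁ - κ') * δ y y')) ≤ S) :
    ∑ x, ω x * g x ≤ M * G * S * Real.exp (-(κ' * δ u v)) := by
  -- regroup the site sum by fibres
  have hfib : ∑ x, ω x * g x = ∑ y, ∑ x, (if π x = y then ω x * g x else 0) := by
    rw [Finset.sum_comm]
    refine Finset.sum_congr rfl fun x _ => ?_
    rw [Finset.sum_ite_eq, if_pos (Finset.mem_univ _)]
  -- one fibre: the weight is at most `M e^{−κ₁δ(u,y)}` on it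
  have hone : ∀ y, ∑ x, (if π x = y then ω x * g x else 0) ≤
      M * Real.exp (-(κ₁ * δ u y)) * (G * Real.exp (-(κ₂ * δ y v))) := by
    intro y
    calc ∑ x, (if π x = y then ω x * g x else 0)
        ≤ ∑ x, (if π x = y then M * Real.exp (-(κ₁ * δ u y)) * g x else 0) := by
          refine Finset.sum_le_sum fun x _ => ?_
          by_cases hx : π x = y
          · rw [if_pos hx, if_pos hx]
            have hωx := hω x
            rw [hx] at hωx
            exact mul_le_mul_of_nonneg_right hωx (hg x)
          · rw [if_neg hx, if_neg hx]
      _ = M * Real.exp (-(κ₁ * δ u y)) * ∑ x, (if π x = y then g x else 0) := by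
          rw [Finset.mul_sum]
          refine Finset.sum_congr rfl fun x _ => ?_
          by_cases hx : π x = y
          · rw [if_pos hx, if_pos hx]
          · rw [if_neg hx, if_neg hx, mul_zero]
      _ ≤ M * Real.exp (-(κ₁ * δ u y)) * (G * Real.exp (-(κ₂ * δ y v))) :=
          mul_le_mul_of_nonneg_left (hblk y) (mul_nonneg hM (Real.exp_pos _).le)
  rw [hfib]
  calc ∑ y, ∑ x, (if π x = y then ω x * g x else 0)
      ≤ ∑ y, M * Real.exp (-(κ₁ * δ u y)) * (G * Real.exp (-(κ₂ * δ y v))) := Finset.sum_le_sum fun y _ => hone y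
    _ = M * G * ∑ y, Real.exp (-(κ₁ * δ u y)) * Real.exp (-(κ₂ * δ y v)) := by
        rw [Finset.mul_sum]
        refine Finset.sum_congr rfl fun y _ => ?_
        ring
    _ ≤ M * G * (S * Real.exp (-(κ' * δ u v))) :=
        mul_le_mul_of_nonneg_left (sum_exp_mul_exp_le hδ0 hδt hκ' h2 hS u v) (mul_nonneg hM hG)
    _ = M * G * S * Real.exp (-(κ' * δ u v)) := by ring

end Conv

/-! ## §2 In the (K1) block currency on `WL2 𝕜 w V` -/

section Blocks

variable {𝕜 : Type*} [RCLike 𝕜] {X Y : Type*} [Fintype X] [Fintype Y] [DecidableEq Y] {w : X → ℝ} [Fact (∀ x, 0 < w x)]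
  {V : Type*} [NormedAddCommGroup V] [InnerProductSpace 𝕜 V]
  {π : X → Y} {P : Y → WL2 𝕜 w V →L[𝕜] WL2 𝕜 w V}
  (hP : ∀ (y : Y) (f : WL2 𝕜 w V) (x : X), WL2.equiv 𝕜 w V (P y f) x = if π x = y then WL2.equiv 𝕜 w V f x else 0)
  {δ : Y → Y → ℝ} (hδ0 : ∀ y y', 0 ≤ δ y y') (hδt : ∀ u y v, δ u v ≤ δ u y + δ y v)

omit [Fintype Y] [DecidableEq Y] in
/-- **BLOCK DECAY OF THE OPERATOR ⟹ BLOCK DECAY OF THE IMAGE OF A ONE-BLOCK SOURCE**: `P_v g = g`, `‖P_y∘T∘P_v‖ ≤ C·e^{−κδ(y,v)}` ⟹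
`‖P_y(T g)‖ ≤ C·e^{−κδ(y,v)}·‖g‖`. [folklore] [cite: Balaban1985BackgroundPropagators, Thm 3.1 (3.42) p.397 «supp λ ⊂ Δ(y′)», (3.49) p.399] -/
theorem norm_block_apply_le_of_block_decay (T : WL2 𝕜 w V →L[𝕜] WL2 𝕜 w V) {v : Y} {g : WL2 𝕜 w V} (hg : P v g = g)
    {C κ : ℝ} (hdec : ∀ y, ‖P y ∘L T ∘L P v‖ ≤ C * Real.exp (-(κ * δ y v))) (y : Y) :
    ‖P y (T g)‖ ≤ C * Real.exp (-(κ * δ y v)) * ‖g‖ := by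
  have e : P y (T g) = (P y ∘L T ∘L P v) g := by
    rw [ContinuousLinearMap.comp_apply, ContinuousLinearMap.comp_apply, hg]
  rw [e]
  exact (ContinuousLinearMap.le_opNorm _ _).trans (mul_le_mul_of_nonneg_right (hdec y) (norm_nonneg _))

include hδ0 hδt in
omit [Fintype Y] [DecidableEq Y] in
/-- **THE DATA-VS-WEIGHT LETTER** (step 2 of storey (D)): block decay `‖P_y f‖ ≤ C·e^{−κδ(y,v)}` (`0 ≤ C`) and a weight dominating
`e^{κ′δ(u,π x)} ≤ M·W(x)` with `0 ≤ κ′ ≤ κ` ⟹ `‖P_{π x} f‖ ≤ C·M·e^{−κ′δ(u,v)}·W(x)` at every site `x` (triangle inequality through `π x`).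
[folklore] [cite: Balaban1985BackgroundPropagators, Thm 3.1 (3.42) p.397, (3.49) p.399] -/
theorem norm_block_apply_le_weight {f : WL2 𝕜 w V} {v : Y} {C κ : ℝ} (hC : 0 ≤ C)
    (hblk : ∀ y, ‖P y f‖ ≤ C * Real.exp (-(κ * δ y v))) (u : Y) {W : X → ℝ} {M κ' : ℝ} (hκ' : 0 ≤ κ') (hκ : κ' ≤ κ)
    (hW : ∀ x, Real.exp (κ' * δ u (π x)) ≤ M * W x) (x : X) :
    ‖P (π x) f‖ ≤ C * M * Real.exp (-(κ' * δ u v)) * W x := by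
  have h1 : Real.exp (-(κ * δ (π x) v)) ≤ Real.exp (-(κ' * δ u v)) * Real.exp (κ' * δ u (π x)) := by
    rw [← Real.exp_add]
    apply Real.exp_le_exp.mpr
    have h3 : κ' * δ u v ≤ κ' * (δ u (π x) + δ (π x) v) := mul_le_mul_of_nonneg_left (hδt u (π x) v) hκ'
    have h4 : κ' * δ (π x) v ≤ κ * δ (π x) v := mul_le_mul_of_nonneg_right hκ (hδ0 _ _)
    linarith
  calc ‖P (π x) f‖ ≤ C * Real.exp (-(κ * δ (π x) v)) := hblk (π x)
    _ ≤ C * (Real.exp (-(κ' * δ u v)) * Real.exp (κ' * δ u (π x))) := mul_le_mul_of_nonneg_left h1 hC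
    _ ≤ C * (Real.exp (-(κ' * δ u v)) * (M * W x)) :=
        mul_le_mul_of_nonneg_left (mul_le_mul_of_nonneg_left (hW x) (Real.exp_pos _).le) hC
    _ = C * M * Real.exp (-(κ' * δ u v)) * W x := by ring

omit [RCLike 𝕜] [InnerProductSpace 𝕜 V] [Fintype X] [Fintype Y] [DecidableEq Y] [Fact (∀ x, 0 < w x)] in
/-- **THE SOURCE-VS-WEIGHT LETTER** (the `f`-half of step 2): a datum supported in the block `v` (`f(x) = 0` unless `π x = v`) with `‖f(x)‖ ≤ F`
(`0 ≤ F`) and a weight `0 ≤ W` dominating `e^{κ′δ(u,π x)} ≤ M·W(x)` (`0 ≤ M`) ⟹ `‖f(x)‖ ≤ F·M·e^{−κ′δ(u,v)}·W(x)` at every site (no triangle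
inequality needed: the domination is read AT the source block). [folklore]
[cite: Balaban1985BackgroundPropagators, Thm 3.1 (3.42) p.397 «supp λ ⊂ Δ(y′)», (3.49) p.399] -/
theorem norm_apply_le_weight_of_support {f : WL2 𝕜 w V} {v : Y} (hfv : ∀ x, π x ≠ v → WL2.equiv 𝕜 w V f x = 0)
    {F : ℝ} (hF0 : 0 ≤ F) (hF : ∀ x, ‖WL2.equiv 𝕜 w V f x‖ ≤ F) (u : Y) {W : X → ℝ} (hW0 : ∀ x, 0 ≤ W x) {M κ' : ℝ} (hM : 0 ≤ M)
    (hW : ∀ x, Real.exp (κ' * δ u (π x)) ≤ M * W x) (x : X) :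
    ‖WL2.equiv 𝕜 w V f x‖ ≤ F * M * Real.exp (-(κ' * δ u v)) * W x := by
  by_cases hx : π x = v
  · have h1 : (1 : ℝ) ≤ M * Real.exp (-(κ' * δ u v)) * W x := by
      have he : 0 < Real.exp (κ' * δ u v) := Real.exp_pos _
      have hx' := hW x
      rw [hx] at hx'
      rw [Real.exp_neg]
      calc (1 : ℝ) = Real.exp (κ' * δ u v) * (Real.exp (κ' * δ u v))⁻¹ := by rw [mul_inv_cancel₀ he.ne']
        _ ≤ M * W x * (Real.exp (κ' * δ u v))⁻¹ := mul_le_mul_of_nonneg_right hx' (inv_nonneg.mpr he.le)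
        _ = M * (Real.exp (κ' * δ u v))⁻¹ * W x := by ring
    calc ‖WL2.equiv 𝕜 w V f x‖ ≤ F := hF x
      _ = F * 1 := (mul_one F).symm
      _ ≤ F * (M * Real.exp (-(κ' * δ u v)) * W x) := mul_le_mul_of_nonneg_left h1 hF0
      _ = F * M * Real.exp (-(κ' * δ u v)) * W x := by ring
  · rw [hfv x hx, norm_zero]
    have : 0 ≤ F * M * Real.exp (-(κ' * δ u v)) * W x := by
      have := hW0 x; positivity
    exact this

include hP hδ0 hδt in
/-- **THE WEIGHTED BRACKET OF STOREY (D) DECAYS** (step 4): block decay `‖P_y f‖ ≤ C·e^{−κδ(y,v)}`, a weight `W > 0` with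
`e^{κ₁δ(u,π x)} ≤ M·W(x)` (`0 ≤ M`), a slower rate `0 ≤ κ′ ≤ 2κ` and `Σ_{y′} e^{−(κ₁−κ′)δ(y,y′)} ≤ S` ⟹
`Σ_x w(x)·‖f(x)‖²∕W(x) ≤ M·C²·S·e^{−κ′δ(u,v)}` (fibres by `norm_sq_block_apply`, then §1). [folklore]
[cite: Balaban1985BackgroundPropagators, Thm 3.1 (3.42) p.397, (3.49) p.399, p.415] -/
theorem weighted_sum_norm_sq_le_of_block_decay {f : WL2 𝕜 w V} {v : Y} {C κ : ℝ}
    (hblk : ∀ y, ‖P y f‖ ≤ C * Real.exp (-(κ * δ y v))) (u : Y) {W : X → ℝ} (hW0 : ∀ x, 0 < W x) {M κ₁ : ℝ} (hM : 0 ≤ M)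
    (hW : ∀ x, Real.exp (κ₁ * δ u (π x)) ≤ M * W x)
    {κ' S : ℝ} (hκ' : 0 ≤ κ') (h2 : κ' ≤ 2 * κ) (hS : ∀ y, ∑ y', Real.exp (-((κ₁ - κ') * δ y y')) ≤ S) :
    ∑ x, w x * ‖WL2.equiv 𝕜 w V f x‖ ^ 2 / W x ≤ M * C ^ 2 * S * Real.exp (-(κ' * δ u v)) := by
  have hw : ∀ x, 0 < w x := Fact.out
  -- the weight `ω = W⁻¹` is dominated by `M e^{−κ₁δ(u,π x)}`
  have hω : ∀ x, (W x)⁻¹ ≤ M * Real.exp (-(κ₁ * δ u (π x))) := by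
    intro x
    rw [inv_le_iff_one_le_mul₀ (hW0 x), Real.exp_neg]
    have hx := hW x
    have he : 0 < Real.exp (κ₁ * δ u (π x)) := Real.exp_pos _
    calc (1 : ℝ) = Real.exp (κ₁ * δ u (π x)) * (Real.exp (κ₁ * δ u (π x)))⁻¹ := by rw [mul_inv_cancel₀ he.ne']
      _ ≤ M * W x * (Real.exp (κ₁ * δ u (π x)))⁻¹ := mul_le_mul_of_nonneg_right hx (inv_nonneg.mpr he.le)
      _ = M * (Real.exp (κ₁ * δ u (π x)))⁻¹ * W x := by ring
  -- the fibre sums are the block norms squared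
  have hblk2 : ∀ y, ∑ x, (if π x = y then w x * ‖WL2.equiv 𝕜 w V f x‖ ^ 2 else 0) ≤ C ^ 2 * Real.exp (-(2 * κ * δ y v)) := by
    intro y
    rw [← norm_sq_block_apply hP y f]
    have h := hblk y
    have h0 : 0 ≤ ‖P y f‖ := norm_nonneg _
    calc ‖P y f‖ ^ 2 ≤ (C * Real.exp (-(κ * δ y v))) ^ 2 := pow_le_pow_left₀ h0 h 2
      _ = C ^ 2 * Real.exp (-(2 * κ * δ y v)) := by
          rw [mul_pow, ← Real.exp_nat_mul]; congr 1; congr 1; push_cast; ring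
  have hmain := sum_mul_le_of_fiber_decay hδ0 hδt π u v (g := fun x => w x * ‖WL2.equiv 𝕜 w V f x‖ ^ 2) (ω := fun x => (W x)⁻¹)
    (fun x => mul_nonneg (hw x).le (sq_nonneg _)) hM hω (sq_nonneg C) hblk2 hκ' h2 hS
  calc ∑ x, w x * ‖WL2.equiv 𝕜 w V f x‖ ^ 2 / W x = ∑ x, (W x)⁻¹ * (w x * ‖WL2.equiv 𝕜 w V f x‖ ^ 2) :=
        Finset.sum_congr rfl fun x _ => by rw [div_eq_inv_mul]
    _ ≤ M * C ^ 2 * S * Real.exp (-(κ' * δ u v)) := hmain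

include hP hδ0 hδt in
/-- … **for `f = T g` with the OPERATOR letter**: `P_v g = g`, `‖P_y∘T∘P_v‖ ≤ C·e^{−κδ(y,v)}` ⟹
`Σ_x w(x)·‖(Tg)(x)‖²∕W(x) ≤ M·(C‖g‖)²·S·e^{−κ′δ(u,v)}`. [folklore] [cite: Balaban1985BackgroundPropagators, Thm 3.1 (3.42) p.397, (3.49) p.399] -/
theorem weighted_sum_norm_sq_le_of_block_decay_op (T : WL2 𝕜 w V →L[𝕜] WL2 𝕜 w V) {v : Y} {g : WL2 𝕜 w V} (hg : P v g = g)
    {C κ : ℝ} (hdec : ∀ y, ‖P y ∘L T ∘L P v‖ ≤ C * Real.exp (-(κ * δ y v)))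
    (u : Y) {W : X → ℝ} (hW0 : ∀ x, 0 < W x) {M κ₁ : ℝ} (hM : 0 ≤ M) (hW : ∀ x, Real.exp (κ₁ * δ u (π x)) ≤ M * W x)
    {κ' S : ℝ} (hκ' : 0 ≤ κ') (h2 : κ' ≤ 2 * κ) (hS : ∀ y, ∑ y', Real.exp (-((κ₁ - κ') * δ y y')) ≤ S) :
    ∑ x, w x * ‖WL2.equiv 𝕜 w V (T g) x‖ ^ 2 / W x ≤ M * (C * ‖g‖) ^ 2 * S * Real.exp (-(κ' * δ u v)) := by
  have hblk : ∀ y, ‖P y (T g)‖ ≤ C * ‖g‖ * Real.exp (-(κ * δ y v)) := fun y => by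
    have h := norm_block_apply_le_of_block_decay (δ := δ) T hg hdec y
    calc ‖P y (T g)‖ ≤ C * Real.exp (-(κ * δ y v)) * ‖g‖ := h
      _ = C * ‖g‖ * Real.exp (-(κ * δ y v)) := by ring
  exact weighted_sum_norm_sq_le_of_block_decay hP hδ0 hδt hblk u hW0 hM hW hκ' h2 hS

end Blocks

/-! ## §3 The lattice letters: `X = T_{Lm}`, `Y = T_m`, `π = blockCoord`, `δ = d_m`; VOLUME-FREE constants (the weight's `hW` inhabitants: `B9Eq342CoshWeightBlockDistance`) -/

section Lattice

variable {𝕜 : Type*} [RCLike 𝕜] {d : ℕ} {L : ℕ} {m : Fin d → ℕ} {c₀ : ℝ} [Fact (0 < c₀)]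
  {V : Type*} [NormedAddCommGroup V] [InnerProductSpace 𝕜 V]
  {P : TSite d m → WL2 𝕜 (fun _ : TSite d (fineP L m) => c₀) V →L[𝕜] WL2 𝕜 (fun _ : TSite d (fineP L m) => c₀) V}
  (hP : ∀ (y : TSite d m) (f : WL2 𝕜 (fun _ : TSite d (fineP L m) => c₀) V) (x : TSite d (fineP L m)),
    WL2.equiv 𝕜 (fun _ : TSite d (fineP L m) => c₀) V (P y f) x =
      if blockCoord L m x = y then WL2.equiv 𝕜 (fun _ : TSite d (fineP L m) => c₀) V f x else 0)

omit [RCLike 𝕜] [InnerProductSpace 𝕜 V] [Fact (0 < c₀)] in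
/-- **THE SOURCE-VS-WEIGHT LETTER ON THE LATTICE**: `f` supported in the block `v` with `‖f(x)‖ ≤ F` (`0 ≤ F`), `e^{κ′·d_m(u, π x)} ≤ M·W(x)` (`0 ≤ W`,
`0 ≤ M`) ⟹ `‖f(x)‖ ≤ F·M·e^{−κ′·d_m(u,v)}·W(x)`. [folklore] [cite: Balaban1985BackgroundPropagators, Thm 3.1 (3.42) p.397, (3.49) p.399] -/
theorem norm_apply_le_weight_of_support_lattice {f : WL2 𝕜 (fun _ : TSite d (fineP L m) => c₀) V} {v : TSite d m}
    (hfv : ∀ x, blockCoord L m x ≠ v → WL2.equiv 𝕜 (fun _ : TSite d (fineP L m) => c₀) V f x = 0)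
    {F : ℝ} (hF0 : 0 ≤ F) (hF : ∀ x, ‖WL2.equiv 𝕜 (fun _ : TSite d (fineP L m) => c₀) V f x‖ ≤ F) (u : TSite d m)
    {W : TSite d (fineP L m) → ℝ} (hW0 : ∀ x, 0 ≤ W x) {M κ' : ℝ} (hM : 0 ≤ M)
    (hW : ∀ x, Real.exp (κ' * tdist m u (blockCoord L m x)) ≤ M * W x) (x : TSite d (fineP L m)) :
    ‖WL2.equiv 𝕜 (fun _ : TSite d (fineP L m) => c₀) V f x‖ ≤ F * M * Real.exp (-(κ' * tdist m u v)) * W x :=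
  norm_apply_le_weight_of_support (π := blockCoord L m) (δ := tdist m) hfv hF0 hF u hW0 hM hW x

/-- **THE DATA-VS-WEIGHT LETTER ON THE LATTICE**: `‖P_y f‖ ≤ C·e^{−κ·d_m(v,y)}` (`0 ≤ C`; the chain's orientation «source block first», as in
(K6T)∕`exists_block_decay_Gp`), `e^{κ′·d_m(u, π x)} ≤ M·W(x)`, `0 ≤ κ′ ≤ κ` ⟹ `‖P_{π x} f‖ ≤ C·M·e^{−κ′·d_m(u,v)}·W(x)`. [folklore] [cite: Balaban1985BackgroundPropagators, Thm 3.1 (3.42) p.397, (3.49) p.399] -/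
theorem norm_block_apply_le_weight_lattice (hm : ∀ i, 1 ≤ m i) {f : WL2 𝕜 (fun _ : TSite d (fineP L m) => c₀) V} {v : TSite d m}
    {C κ : ℝ} (hC : 0 ≤ C) (hblk : ∀ y, ‖P y f‖ ≤ C * Real.exp (-(κ * tdist m v y))) (u : TSite d m)
    {W : TSite d (fineP L m) → ℝ} {M κ' : ℝ} (hκ' : 0 ≤ κ') (hκ : κ' ≤ κ)
    (hW : ∀ x, Real.exp (κ' * tdist m u (blockCoord L m x)) ≤ M * W x) (x : TSite d (fineP L m)) :
    ‖P (blockCoord L m x) f‖ ≤ C * M * Real.exp (-(κ' * tdist m u v)) * W x :=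
  norm_block_apply_le_weight (P := P) (π := blockCoord L m) (δ := tdist m) (tdist_nonneg m) (tdist_triangle hm) hC
    (fun y => by have h := hblk y; rwa [tdist_symm hm v y] at h) u hκ' hκ hW x

include hP in
/-- **THE WEIGHTED BRACKET OF STOREY (D) DECAYS ON THE LATTICE, VOLUME-FREE**: `‖P_y f‖ ≤ C·e^{−κ·d_m(v,y)}` (source block first), a weight `W > 0` on the fine
torus with `e^{κ₁·d_m(u, π x)} ≤ M·W(x)` (`0 ≤ M`), and a slower rate `0 ≤ κ′ < κ₁`, `κ′ ≤ 2κ` ⟹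
`Σ_x c₀‖f(x)‖²∕W(x) ≤ M·C²·K_d(κ₁ − κ′)·e^{−κ′·d_m(u,v)}` with `K_d = latticeConst` (`B4Sect5Torus.torusSum_le`), independent of the volume `m`.
[folklore] [cite: Balaban1985BackgroundPropagators, Thm 3.1 (3.42) p.397, (3.49) p.399, p.415] -/
theorem weighted_sum_norm_sq_le_of_block_decay_lattice (hm : ∀ i, 1 ≤ m i) {f : WL2 𝕜 (fun _ : TSite d (fineP L m) => c₀) V}
    {v : TSite d m} {C κ : ℝ} (hblk : ∀ y, ‖P y f‖ ≤ C * Real.exp (-(κ * tdist m v y))) (u : TSite d m)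
    {W : TSite d (fineP L m) → ℝ} (hW0 : ∀ x, 0 < W x) {M κ₁ : ℝ} (hM : 0 ≤ M)
    (hW : ∀ x, Real.exp (κ₁ * tdist m u (blockCoord L m x)) ≤ M * W x)
    {κ' : ℝ} (hκ' : 0 ≤ κ') (h1 : κ' < κ₁) (h2 : κ' ≤ 2 * κ) :
    ∑ x, c₀ * ‖WL2.equiv 𝕜 (fun _ : TSite d (fineP L m) => c₀) V f x‖ ^ 2 / W x ≤
      M * C ^ 2 * latticeConst d (κ₁ - κ') * Real.exp (-(κ' * tdist m u v)) :=
  weighted_sum_norm_sq_le_of_block_decay (P := P) (π := blockCoord L m) (δ := tdist m) hP (tdist_nonneg m) (tdist_triangle hm)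
    (fun y => by have h := hblk y; rwa [tdist_symm hm v y] at h) u hW0 hM hW hκ' h2 (fun y => torusSum_le d hm (sub_pos.mpr h1) y)

include hP in
/-- … **with the OPERATOR letter** (`f = T g`, `P_v g = g`, `‖P_y∘T∘P_v‖ ≤ C·e^{−κ·d_m(v,y)}` — VERBATIM the `hdec` shape of (K6T) ∕ `exists_block_decay_Gp`):
`Σ_x c₀‖(Tg)(x)‖²∕W(x) ≤ M·(C‖g‖)²·K_d(κ₁ − κ′)·e^{−κ′·d_m(u,v)}`. [folklore] [cite: Balaban1985BackgroundPropagators, Thm 3.1 (3.42) p.397, (3.49) p.399] -/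
theorem weighted_sum_norm_sq_le_of_block_decay_op_lattice (hm : ∀ i, 1 ≤ m i)
    (T : WL2 𝕜 (fun _ : TSite d (fineP L m) => c₀) V →L[𝕜] WL2 𝕜 (fun _ : TSite d (fineP L m) => c₀) V)
    {v : TSite d m} {g : WL2 𝕜 (fun _ : TSite d (fineP L m) => c₀) V} (hg : P v g = g)
    {C κ : ℝ} (hdec : ∀ y, ‖P y ∘L T ∘L P v‖ ≤ C * Real.exp (-(κ * tdist m v y))) (u : TSite d m)
    {W : TSite d (fineP L m) → ℝ} (hW0 : ∀ x, 0 < W x) {M κ₁ : ℝ} (hM : 0 ≤ M)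
    (hW : ∀ x, Real.exp (κ₁ * tdist m u (blockCoord L m x)) ≤ M * W x)
    {κ' : ℝ} (hκ' : 0 ≤ κ') (h1 : κ' < κ₁) (h2 : κ' ≤ 2 * κ) :
    ∑ x, c₀ * ‖WL2.equiv 𝕜 (fun _ : TSite d (fineP L m) => c₀) V (T g) x‖ ^ 2 / W x ≤
      M * (C * ‖g‖) ^ 2 * latticeConst d (κ₁ - κ') * Real.exp (-(κ' * tdist m u v)) :=
  weighted_sum_norm_sq_le_of_block_decay_op (P := P) (π := blockCoord L m) (δ := tdist m) hP (tdist_nonneg m) (tdist_triangle hm) T hg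
    (fun y => by have h := hdec y; rwa [tdist_symm hm v y] at h) u hW0 hM hW hκ' h2 (fun y => torusSum_le d hm (sub_pos.mpr h1) y)

end Lattice

end Literature.MathematicalPhysics.QuantumFieldTheory.Balaban1983to89.B9Eq342BlockDecayWeightedSum

end

-- comment-only re-land 2026-08-24 (ne9-leaf-06 g72): forces the olean build of this casualty of the 2026-08-23 ENOSPC incident
-- (accepted 2026-08-23, never built; ops BUILD-ENQUEUE-bf3g18-casualties); every declaration above is byte-identical to the accepted file.
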